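import Mathlib
import Summits.Ventures.HodgeRepro.Tier4.Target
import Summits.Ventures.HodgeRepro.Tier4.Line3.Defs
import Summits.Ventures.HodgeRepro.Tier4.Line3.LocaliserS
import Summits.Ventures.HodgeRepro.Tier4.Line3.ClassBoundGauss
import Summits.Ventures.HodgeRepro.Tier4.Line3.InvariantMajorantDef
import Summits.Ventures.HodgeRepro.Tier4.Line3.InvariantClassBound
import Summits.Ventures.HodgeRepro.Tier4.Line3.GrowthInvOfGauss
import Summits.Ventures.HodgeRepro.Tier4.Line3.GrowthInvOfMajorant
import Summits.Ventures.HodgeRepro.Tier4.Line3.HeckeMassBounds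
import Summits.Ventures.HodgeRepro.Tier4.Line3.GaussGrowthOfSize
import Summits.Ventures.HodgeRepro.Tier4.Line3.RayClassBound
import Summits.Ventures.HodgeRepro.Tier4.Line3.GrowthOn

/-!
# Tier4/Line3/GaussGrowthOn — the (G₀) chain on a bare family of translates (the O-L3-8 repair's `…On` forms)

Blind re-derivation cell `pub-hodge-repro`, Tier 4 «PROVE THE STEP» (README §9–§10), LINE L3, seat t4-L2-p1 g2.

The O-L3-8 repair (L3 v0.39, t4-plan-3 g3 S13492 / S13557) states every growth clause on the bare data `level`/`loc`
of a localiser (`GrowthInvOn`, RayClassBound p679081; `LocSizeOn`, GrowthOn p680681), so that the interface structure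
can change without touching the theorems.  This module ports the (G₀) chain of GrowthInvOfGauss p675335 /
GaussGrowthOfSize p677000 to that form — the same proofs, `ℓ.loc` replaced by `loc`:

* `GaussGrowthOn D loc` — the pointwise Gauss-growth clause (G₀) on `loc` (`GaussGrowth D ℓ ↔ GaussGrowthOn D ℓ.loc`);
* `growthInvOn_of_gaussGrowthOn` — `GaussGrowthOn D loc → GrowthInvOn D loc` (half-Gaussian split + uniform
  comparability, `e = 0`, `c₀ ↦ c₀/(2R)`);
* `gaussGrowthOn_of_locSizeOn` — `SlotGauss D → LocSizeOn loc → GaussGrowthOn D loc` ((G₀-c) on `loc`);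
* `growthInvOn_of_slotGauss` — the composite `SlotGauss D → LocSizeOn loc → GrowthInvOn D loc`, the (G₀) form of the
  growth interface for v0.39 (beside L2-p3 g3's content form `growthInvOn_of_contentBound`).

Nothing here asserts anything about the truth of (P); HC_CM is NOT proved by anyone in this repository.
-/

set_option autoImplicit false

noncomputable section

namespace Summit.Ventures.HodgeRepro.Tier4.Line3

open Summit.Ventures.HodgeRepro.Tier4
open Matrix NumberField
open scoped ComplexConjugate

namespace T4Data

variable (X : T4Data)

/-- (G₀) on a bare family of translates: `‖coefQ (loc N) (rep w)‖ ≤ B q₂^N ∏_k gaussDefAt c₀ (rep w k)`. -/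
def GaussGrowthOn (D : X.ThetaData) {level : ℕ → X.Level} (loc : ∀ N, X.Tr (level N)) : Prop :=
  ∃ B q₂ c₀ : ℝ, 0 < c₀ ∧ 0 ≤ q₂ ∧ ∀ (N : ℕ) (w : X.LineTuple),
    ‖X.coefQ D.cf (loc N) (X.rep w)‖ ≤ B * q₂ ^ N * ∏ k, X.gaussDefAt c₀ (X.rep w k)

/-- `GaussGrowth` of a localiser is `GaussGrowthOn` of its `loc`. -/
theorem gaussGrowth_iff_gaussGrowthOn (D : X.ThetaData)
    {p : IsDedekindDomain.HeightOneSpectrum (RingOfIntegers X.E)}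
    {L₀ : Submodule (RingOfIntegers X.E) (Fin 3 → X.E)} {xm : X.Tuple} (ℓ : X.LocS D p L₀ xm) :
    X.GaussGrowth D ℓ ↔ X.GaussGrowthOn D ℓ.loc := Iff.rfl

/-- **THE `Γ`-INVARIANT GROWTH CLAUSE FROM THE POINTWISE GAUSSIAN BOUND, on `loc`** (`growthInv_of_gaussGrowth`
verbatim with `ℓ.loc` replaced by `loc`). -/
theorem growthInvOn_of_gaussGrowthOn (D : X.ThetaData) {level : ℕ → X.Level} (loc : ∀ N, X.Tr (level N))
    (hg : X.GaussGrowthOn D loc) : X.GrowthInvOn D loc := by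
  obtain ⟨B, q₂, c₀, hc₀, hq₂, hbound⟩ := hg
  obtain ⟨R, hR1, hR⟩ := X.exists_uniform_comparability
  have hRpos : 0 < R := zero_lt_one.trans_le hR1
  set c : ℝ := c₀ / (2 * R) with hc
  have hcpos : 0 < c := by positivity
  have hcR : c * R = c₀ / 2 := by
    rw [hc]
    field_simp
  have hc_le : c ≤ c₀ / 2 := by
    rw [hc, div_le_div_iff₀ (by positivity) (by positivity)]
    nlinarith [hc₀, hR1]
  refine ⟨max B 0, q₂, 0, c, hcpos, hq₂, fun N w g => ?_⟩
  refine (hbound N w).trans ?_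
  have hprod0 : 0 ≤ ∏ k, X.gaussDefAt c₀ (X.rep w k) :=
    Finset.prod_nonneg fun k _ => X.gaussDefAt_nonneg _ _
  have hq : 0 ≤ q₂ ^ N := pow_nonneg hq₂ N
  have hmain : ∏ k, X.gaussDefAt c₀ (X.rep w k) ≤
      X.quadMaj 0 c (X.rep w) g * ∏ k, X.gaussDefAt c (X.rep w k) := by
    unfold quadMaj
    rw [← Finset.prod_mul_distrib]
    refine Finset.prod_le_prod (fun k _ => X.gaussDefAt_nonneg _ _) fun k _ => ?_
    rw [X.slotMaj_zero, ← X.gaussDefAt_half_mul_self]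
    refine mul_le_mul ?_ (X.gaussDefAt_anti hc_le _) (X.gaussDefAt_nonneg _ _) (X.gaussDefAt_nonneg _ _)
    rw [← hcR]
    exact X.gaussDefAt_le_of_unitary hR hcpos.le (X.isUnitaryOf_of_mem_Γ (g k).2) _
  calc B * q₂ ^ N * ∏ k, X.gaussDefAt c₀ (X.rep w k)
      ≤ max B 0 * q₂ ^ N * ∏ k, X.gaussDefAt c₀ (X.rep w k) := by
        gcongr
        exact le_max_left _ _
    _ ≤ max B 0 * q₂ ^ N * (X.quadMaj 0 c (X.rep w) g * ∏ k, X.gaussDefAt c (X.rep w k)) := by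
        gcongr
    _ = max B 0 * q₂ ^ N * X.quadMaj 0 c (X.rep w) g * ∏ k, X.gaussDefAt c (X.rep w k) := by ring

/-- **(G₀-c) on `loc`**: (G₀) from (cf-G) on the data and `LocSizeOn` on the translates (`gaussGrowth_of_locSize`
verbatim with `ℓ.loc` replaced by `loc`). -/
theorem gaussGrowthOn_of_locSizeOn (D : X.ThetaData) {level : ℕ → X.Level} (loc : ∀ N, X.Tr (level N))
    (hcf : X.SlotGauss D) (hsize : X.LocSizeOn loc) : X.GaussGrowthOn D loc := by
  obtain ⟨C, c₀, hc₀, hcf⟩ := hcf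
  obtain ⟨B, q₂, _hB, hq₂, hsize⟩ := hsize
  obtain ⟨R, hR1, hR⟩ := X.exists_uniform_comparability_rev
  have hRpos : 0 < R := zero_lt_one.trans_le hR1
  have hcf' : ∀ j x, ‖D.cf j x‖ ≤ max C 0 * X.gaussDefAt c₀ x := fun j x =>
    (hcf j x).trans (mul_le_mul_of_nonneg_right (le_max_left _ _) (X.gaussDefAt_nonneg _ _))
  refine ⟨B * max C 0 ^ 4, q₂, c₀ / R, by positivity, hq₂, fun N w => ?_⟩
  have hprod : 0 ≤ max C 0 ^ 4 * ∏ k, X.gaussDefAt (c₀ / R) (X.rep w k) :=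
    mul_nonneg (by positivity) (Finset.prod_nonneg fun k _ => X.gaussDefAt_nonneg _ _)
  calc ‖X.coefQ D.cf (loc N) (X.rep w)‖
      ≤ X.trSize (loc N) * (max C 0 ^ 4 * ∏ k, X.gaussDefAt (c₀ / R) (X.rep w k)) :=
        X.norm_coefQ_le_trSize_gauss D (loc N) hRpos hR (le_max_right _ _) hc₀.le hcf' (X.rep w)
    _ ≤ B * q₂ ^ N * (max C 0 ^ 4 * ∏ k, X.gaussDefAt (c₀ / R) (X.rep w k)) :=
        mul_le_mul_of_nonneg_right (hsize N) hprod
    _ = B * max C 0 ^ 4 * q₂ ^ N * ∏ k, X.gaussDefAt (c₀ / R) (X.rep w k) := by ring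

/-- **THE (G₀) FORM OF THE GROWTH INTERFACE ON `loc`**: `SlotGauss D → LocSizeOn loc → GrowthInvOn D loc`. -/
theorem growthInvOn_of_slotGauss (D : X.ThetaData) {level : ℕ → X.Level} (loc : ∀ N, X.Tr (level N))
    (hcf : X.SlotGauss D) (hsize : X.LocSizeOn loc) : X.GrowthInvOn D loc :=
  X.growthInvOn_of_gaussGrowthOn D loc (X.gaussGrowthOn_of_locSizeOn D loc hcf hsize)

end T4Data

end Summit.Ventures.HodgeRepro.Tier4.Line3

end
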